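import Summits.QuantumAdvantage.QuantumAdvantage.Theorems.CharDialColumnDialA3
import Summits.QuantumAdvantage.QuantumAdvantage.Theorems.CharDialTokenDialB
import HarnessLib

/-!
# CharDial — the SYMMETRIC-BLOCK LAW (part B1): CASE I; preparations for CASE II

Tree twin, part B1 (§3.5–3.6a), of the decomp-qadv lens-5 g34 node `Theses/ColumnDial.lean`; imports part A3.  On a fibre `Xf p S z μ`
(outside word `z`, block weight `≡ μ (p)`): CASE I (`caseI`) — no active inner group: the outcome is an even pattern of `wt_S mod 3`, so a
whole residue class mod `3p` of the fibre loses; preparations for CASE II: a cut in an active group (`exists_rep_of_copoint`), the involution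
pairing (`card_le_two_mul_losers`), the bad residues (`exists_bad_residue_P/Q`, by `decide`), `cos_aux`, and the two-slice count (`slice_count`).
Kernel-checked, no `sorry`, no instances, no notation.  Memo: decomp-qadv-lens-5/g34/NODE-g34.md (§9 proof map, §10 land package); blueprint BLUEPRINT-g34.md.  Re-cut of the staged part B (cf96495d) at section boundaries (≤ 400 lines per file, every declaration docstringed); declaration bodies byte-identical.
-/

set_option autoImplicit false
set_option linter.dupNamespace false

namespace Summit.QuantumAdvantage.QuantumAdvantage.Theorems.ColumnDial

open Finset
open Summit.QuantumAdvantage.AdviceFreeQNC0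

section Law

variable {n : ℕ}

/-! #### 3.5 CASE I — no active inner group: a whole class of the block weight mod 3 loses -/

/-- ★ CASE I: if no inner group is active on the class of `u₀`, at least `2^|S|/(3p) − (2cos(π/3p))^|S|` words of the class lose. -/
theorem caseI {p : ℕ} (hp : 1 ≤ p) (h3p : Nat.Coprime 3 p) {S : Finset (Fin n)}
    {y : Fin (n + 1) → (Fin n → Bool) → Bool} (hS : SymBlock p S y) (c : ℕ)
    {z : Fin n → Bool} {μ : ZMod p} (hm : 1 ≤ S.card) {u₀ : Fin n → Bool} (hu₀ : u₀ ∈ Xf p S z μ)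
    (hI : ∀ k, 1 ≤ k → k < S.card → ∀ t, phasePat (fired S y u₀ k) (eZ c S u₀) t = false) :
    (2 : ℝ) ^ S.card / (3 * p) - (2 * Real.cos (Real.pi / (3 * p))) ^ S.card ≤
      (((Xf p S z μ).filter fun u => ringWinU c y u = false).card : ℝ) := by
  haveI : NeZero p := ⟨by omega⟩
  -- the two outer bells (patterns of groups 0 and m, defined at u₀) lose at some residue ν₀
  obtain ⟨ν₀, hν₀⟩ := outer_bells_lose_somewhere (fun t => phasePat (fired S y u₀ 0) (eZ c S u₀) t)
    (fun t => phasePat (fired S y u₀ S.card) (eZ c S u₀) t) (phasePat_even _ _) (phasePat_even _ _)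
  -- the class wt_S ≡ μ (p), ≡ ν₀ (3) inside the fibre over z loses entirely
  have hsub : ((fib S z).filter fun u =>
      ((SubChar.bw S u : ℕ) : ZMod p) = μ ∧ ((SubChar.bw S u : ℕ) : ZMod 3) = ν₀) ⊆
      ((Xf p S z μ).filter fun u => ringWinU c y u = false) := by
    intro u hu
    rw [Finset.mem_filter] at hu
    obtain ⟨huf, hμ, hν⟩ := hu
    have huX : u ∈ Xf p S z μ := mem_Xf.2 ⟨huf, hμ⟩
    rw [Finset.mem_filter]
    refine ⟨huX, ?_⟩
    -- parity bookkeeping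
    have hfired : ∀ k, fired S y u k = fired S y u₀ k := fun k => fired_eq_of_mem_Xf hS huX hu₀ k
    have heZ : eZ c S u = eZ c S u₀ := eZ_eq_of_mem_fib huf (mem_Xf.1 hu₀).1
    have hinner : ∀ k, 1 ≤ k → k < S.card → (dgrp c S y u k).card % 2 = 0 := by
      intro k hk1 hk2
      by_cases hne : ∃ g₀ : Fin (n + 1), kappa S g₀ = k
      · obtain ⟨g₀, hg₀⟩ := hne
        have hd := decide_dgrp c S y u hg₀
        rw [hfired, heZ, hI k hk1 hk2] at hd
        have : ¬ ((dgrp c S y u k).card % 2 = 1) := of_decide_eq_false hd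
        omega
      · push Not at hne
        rw [dgrp_eq_empty c S y u hne, Finset.card_empty]
    have h0 := decide_dgrp c S y u (kappa_zero S)
    have hmm := decide_dgrp c S y u (kappa_last S)
    rw [pre_zero] at h0
    rw [pre_last] at hmm
    rw [hfired, heZ] at h0 hmm
    have hbw0 : ((SubChar.bw S u + SubChar.bw (∅ : Finset (Fin n)) u : ℕ) : ZMod 3) = ν₀ := by
      rw [show SubChar.bw (∅ : Finset (Fin n)) u = 0 from by simp [SubChar.bw], add_zero, hν]
    have hbwm : ((SubChar.bw S u + SubChar.bw S u : ℕ) : ZMod 3) = 2 * ν₀ := by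
      rw [← two_mul, Nat.cast_mul, Nat.cast_two, hν]
    rw [hbw0] at h0
    rw [hbwm] at hmm
    rw [ringWinU_eq, card_dset_split c S y u hm, SumCodeZero.decide_add_mod_two, SumCodeZero.decide_add_mod_two, h0, hmm]
    have hin := inner_even c S y u hinner
    rw [show decide (((dset c y u).filter fun g => kappa S g ≠ 0 ∧ kappa S g ≠ S.card).card % 2 = 1) = false from by
      rw [hin]; decide]
    rw [Bool.xor_false]
    exact hν₀
  have hc : (((fib S z).filter fun u =>
      ((SubChar.bw S u : ℕ) : ZMod p) = μ ∧ ((SubChar.bw S u : ℕ) : ZMod 3) = ν₀).card : ℝ) ≤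
      (((Xf p S z μ).filter fun u => ringWinU c y u = false).card : ℝ) := by
    exact_mod_cast Finset.card_le_card hsub
  exact (fib_two_moduli_ge hp h3p S z μ ν₀).trans hc

/-! #### 3.6 CASE II — an active inner group: the transposition reverses the outcome on the flip set -/

/-- an active group is represented by a cut. -/
theorem exists_rep_of_copoint {S : Finset (Fin n)} {y : Fin (n + 1) → (Fin n → Bool) → Bool} {u₀ : Fin n → Bool}
    {e : Fin (n + 1) → ZMod 3} {a : ℕ} {ρ : ZMod 3} (hρ : ∀ t, phasePat (fired S y u₀ a) e t = decide (t ≠ ρ)) :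
    ∃ g₀ : Fin (n + 1), kappa S g₀ = a := by
  by_contra h
  push Not at h
  have hempty : fired S y u₀ a = ∅ := by
    rw [Finset.eq_empty_iff_forall_notMem]
    intro g hg
    exact h g (Finset.mem_filter.1 (Finset.mem_filter.1 hg).1).2
  have h1 := hρ (ρ + 1)
  rw [hempty, phasePat_empty] at h1
  have h2 : ∀ r : ZMod 3, decide (r + 1 ≠ r) = true := by decide
  rw [h2 ρ] at h1
  exact Bool.false_ne_true h1

/-- an outcome-reversing involution of `X` defined on `F' ⊆ X` forces `|F'| ≤ 2 · #{losers in X}`. -/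
theorem card_le_two_mul_losers (X F' : Finset (Fin n → Bool)) (T : (Fin n → Bool) → (Fin n → Bool))
    (W : (Fin n → Bool) → Bool) (hF : F' ⊆ X) (hT : ∀ u ∈ X, T u ∈ X) (hTT : ∀ u, T (T u) = u)
    (hflip : ∀ u ∈ F', W (T u) ≠ W u) :
    F'.card ≤ 2 * (X.filter fun u => W u = false).card := by
  have hsplit := Finset.card_filter_add_card_filter_not (s := F') (fun u => W u = true)
  have h1 : (F'.filter fun u => W u = true).card ≤ (X.filter fun u => W u = false).card := by
    refine Finset.card_le_card_of_injOn T ?_ ?_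
    · intro u hu
      have hu' : u ∈ F'.filter fun u => W u = true := by exact_mod_cast hu
      rw [Finset.mem_filter] at hu'
      have hm : T u ∈ X.filter fun u => W u = false := by
        rw [Finset.mem_filter]
        refine ⟨hT u (hF hu'.1), ?_⟩
        have h := hflip u hu'.1
        rw [hu'.2] at h
        cases hTu : W (T u)
        · rfl
        · exact absurd hTu h
      exact_mod_cast hm
    · intro u _ v _ huv
      have h := congrArg T huv
      rwa [hTT, hTT] at h
  have h2 : (F'.filter fun u => ¬ W u = true).card ≤ (X.filter fun u => W u = false).card := by
    refine Finset.card_le_card ?_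
    intro u hu
    rw [Finset.mem_filter] at hu ⊢
    refine ⟨hF hu.1, ?_⟩
    cases hWu : W u
    · rfl
    · exact absurd hWu hu.2
  omega

/-- the residue bookkeeping of the flip set, `Q` side: all but one residue of the free weight is good … -/
theorem exists_bad_residue_Q : ∀ C ρ : ZMod 3, ∃ b : ZMod 3, ∀ q : ZMod 3, q ≠ b → (q + C = ρ ∨ q + C + 1 = ρ) := by
  decide

/-- … and `P` side (the free weight enters twice). -/
theorem exists_bad_residue_P : ∀ D ρ : ZMod 3, ∃ b : ZMod 3, ∀ x : ZMod 3, x ≠ b →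
    (x + D + x = ρ ∨ x + D + x + 1 = ρ) := by
  decide

/-- ★ SLICE COUNT for the flip set: slicing over the keys `w` (free part `A ⊆ S` zeroed, the two transposed bits unequal), each slice
contributing a full `(mod p, avoid one residue mod 3)` class of the free weight, gives `2^{|S|}/3p − 2^{|S|} cos(π/3p)^L` once `|A| ≥ L`. -/
theorem slice_count {p : ℕ} (hp : 1 ≤ p) (h3p : Nat.Coprime 3 p) {S A : Finset (Fin n)} (hAS : A ⊆ S)
    {z : Fin n → Bool} (hz : ∀ k ∈ S, z k = false) {i j : Fin n} (hiS : i ∈ S) (hiA : i ∉ A) (hij : i ≠ j)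
    (F : Finset (Fin n → Bool))
    (hslice : ∀ w ∈ (fib (S \ A) z).filter (fun w => w i ≠ w j), ∃ (a : ZMod p) (b : ZMod 3), ∀ u ∈ fib A w,
      ((SubChar.bw A u : ℕ) : ZMod p) = a → ((SubChar.bw A u : ℕ) : ZMod 3) ≠ b → u ∈ F)
    {L : ℕ} (hL : L ≤ A.card) :
    (2 : ℝ) ^ S.card / (3 * p) - (2 : ℝ) ^ S.card * (Real.cos (Real.pi / (3 * p))) ^ L ≤ (F.card : ℝ) := by
  obtain ⟨hC0, hC1⟩ := Summit.QuantumAdvantage.AdviceFreeQNC0.JLinPeel.TokenDial.cos_facts hp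
  have hK : ∀ w ∈ (fib (S \ A) z).filter (fun w => w i ≠ w j), ∀ k ∈ A, w k = false := by
    intro w hw k hk
    have hwf := (Finset.mem_filter.1 hw).1
    have hkS : k ∉ S \ A := fun h => (Finset.mem_sdiff.1 h).2 hk
    rw [(mem_fib.1 hwf) k hkS]
    exact hz k (hAS hk)
  have h := card_ge_of_slices hp h3p A _ F hK hslice
  have hK2 := two_mul_card_fib_filter_ne (S \ A) z (Finset.mem_sdiff.2 ⟨hiS, hiA⟩) hij
  have hSA : (S \ A).card + A.card = S.card := Finset.card_sdiff_add_card_eq_card hAS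
  have hKR : (2 : ℝ) * (((fib (S \ A) z).filter (fun w => w i ≠ w j)).card : ℝ) = (2 : ℝ) ^ (S \ A).card := by
    exact_mod_cast hK2
  have hpow : (2 : ℝ) ^ (S \ A).card * (2 : ℝ) ^ A.card = (2 : ℝ) ^ S.card := by
    rw [← pow_add, hSA]
  have hCA : (Real.cos (Real.pi / (3 * p))) ^ A.card ≤ (Real.cos (Real.pi / (3 * p))) ^ L :=
    pow_le_pow_of_le_one hC0 hC1.le hL
  have h2S : (0 : ℝ) ≤ (2 : ℝ) ^ S.card := by positivity
  have hmono : (2 : ℝ) ^ S.card * (Real.cos (Real.pi / (3 * p))) ^ A.card ≤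
      (2 : ℝ) ^ S.card * (Real.cos (Real.pi / (3 * p))) ^ L := mul_le_mul_of_nonneg_left hCA h2S
  have hmain : ((((fib (S \ A) z).filter (fun w => w i ≠ w j)).card : ℝ)) *
      (2 * ((2 : ℝ) ^ A.card / (3 * p) - (2 * Real.cos (Real.pi / (3 * p))) ^ A.card)) =
      (2 : ℝ) ^ S.card / (3 * p) - (2 : ℝ) ^ S.card * (Real.cos (Real.pi / (3 * p))) ^ A.card := by
    rw [mul_pow, ← hpow, ← hKR]; ring
  linarith

end Law

end Summit.QuantumAdvantage.QuantumAdvantage.Theorems.ColumnDial
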